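import Summits.NavierStokesRegularity.NavierStokesRegularity.Theorems.SheetLawsOddContrastSubsolution
import HarnessLib

/-!
# SHEET LAWS (ROUND-21 of nsreg-p2): S-21.1 `OddContrastMaxPrinciple` PROVED — the maximum principle
# for the odd contrast `χ = Γ/z`, and S-21.2 `OddClassDSSCompressionLaw` unconditionally

Prover seat nsreg-p4 (gen 14), seed s21-3 of the planner nsreg-p2 (gen 23); line material of the route
`SwirlThreshold` (`--supports stmt-NavierStokesRegularity-2002`); theorems only.

* `sign_mul_dampedSmoothContrast_le` — the one-sided comparison: along a classical solution of the
  unforced Navier–Stokes system (`ν ≥ 0`) on `[s, t] × ℝ³` in the axisymmetric odd-swirl class, with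
  `χ` decaying at spatial infinity uniformly on `[s, t]`, `|χ(s, ·)| ≤ C₀` and a continuous majorant
  `-u_z/z ≤ k` off the sheet: `σ e^{-∫ₛ^τ k} χ̃(τ, x) ≤ C₀` for `σ = ±1`, all `τ ∈ [s, t]`, all `x`
  (`χ̃ = zQuot Γ` the smooth even representative of `χ`).
* `oddContrastMaxPrinciple_holds : OddContrastMaxPrinciple` — **S-21.1** (`Theorems/SheetLaws.lean`,
  the planner's support statement) as a kernel theorem;
* `oddClassDSSCompressionLaw_holds : OddClassDSSCompressionLaw` — **S-21.2**, the DSS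
  sheet-compression law, now unconditional (the planner's `oddClassDSSCompressionLaw_of_maxPrinciple`).

## The comparison argument

The tree's pattern for the swirl (`Literature/Analysis/FluidPDE/SwirlMaximumPrinciple.lean`,
Lei–Zhang (1.4) / KNSS (1.9) via Lieberman's weak maximum principle), transplanted to the damped
contrast `χ̂ = e^{-K}χ̃`, `K(τ) = ∫ₛ^τ k`.  By `smoothContrast_equation` (off the axis, sheet
included) `∂ₜχ̂ + Dχ̂[u] + (c̃ + k)χ̂ = ν(Δχ̂ − (2/r)Dχ̂[e_r] + 2Q̂)`, `c̃ = zQuot u_z ≥ -k`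
(`zQuot_apply_two_add_nonneg`), `Q̂ = zQuot(∂₂χ̂)` (`= ∂₂χ̂/z` off the sheet, `= ∂₂∂₂χ̂` on it).
Apply `weak_max_principle_pos` on `K = B̄(0,R)`, `U = B(0,R) ∖ {axis}` to
`w = σχ̂ − h`, `h = M + c(1+|x|²)`, `c = ε e^{β(τ-s)}`, `β = 10ν + V + 1`, `V = sup|u|` on
`[s,t] × B̄(0,R)`: at a positive local maximum `σ∇χ̂ = ∇h = 2c⟨x,·⟩`, `σΔχ̂ ≤ 6c`,
`σ∂₂∂₂χ̂ ≤ ∂₂∂₂h = 2c`, so `νσΔχ̂ ≤ 6νc`, `−(2ν/r)∂ᵣh ≤ 0`, `2νσQ̂ = (2ν/z)·2cz = 4νc` off the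
sheet and `≤ 4νc` on it, the drift term is `≤ 2cV|x|`, and the potential `−(c̃+k)σχ̂ ≤ 0` because
`σχ̂ > h > 0` there; hence `σχ̂ₜ ≤ (10ν + V)c(1+|x|²) < hₜ`.  Parabolic boundary: `t = s`
(`|χ̃(s)| ≤ C₀ ≤ M`), the axis (`χ̃ = 0`), the sphere `|x| = R ≥ R₀` (`|χ̂| ≤ η/2 ≤ M` by the decay
hypothesis).  Sheet points are handled by continuity from off the sheet throughout
(`le_of_forall_off_sheet`).  With `M = C₀ + η/2`, `R ≥ |x₀|` FIXED FIRST (so no global velocity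
bound is needed) and then `ε` small, `σχ̂(τ₀,x₀) ≤ C₀ + η` for every `η > 0`.

WHAT THIS IS NOT: not a regularity criterion and not a claim about any blow-up scenario — a classical
parabolic maximum principle (support statement S-21.1 of the planner's ROUND-21) and its kinematic
DSS consequence S-21.2; the crux `SmallSwirlRegularity` (stmt-2002) and all hard cores are untouched.
-/

namespace Summit.NavierStokesRegularity.NavierStokesRegularity.Theorems.SheetLaws

open MeasureTheory Set Filter Topology Metric WithLp Function InnerProductSpace
open scoped ContDiff RealInnerProductSpace Laplacian
open Literature.Analysis Literature.Analysis.FluidPDE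

noncomputable section

variable {s t ν : ℝ} {u : ℝ → EuclideanSpace ℝ (Fin 3) → EuclideanSpace ℝ (Fin 3)}
  {p : ℝ → EuclideanSpace ℝ (Fin 3) → ℝ}

/-- Transfer of an absolute-value bound from off the sheet to everywhere, for a continuous function
(used for the initial bound, the decay bound and the axis). -/
theorem abs_le_of_forall_off_sheet {g : EuclideanSpace ℝ (Fin 3) → ℝ} (hg : Continuous g) {b R₀ : ℝ}
    (h : ∀ y : EuclideanSpace ℝ (Fin 3), y 2 ≠ 0 → R₀ ≤ ‖y‖ → |g y| ≤ b)
    (x : EuclideanSpace ℝ (Fin 3)) (hx : R₀ ≤ ‖x‖) : |g x| ≤ b := by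
  by_cases hz : x 2 ≠ 0
  · exact h x hz hx
  · push Not at hz
    exact le_of_forall_off_sheet (g := fun y => |g y|) (continuous_abs.comp hg).continuousAt hz
      fun y hy _ hxy => h y hy (hx.trans hxy)

/-- **One-sided comparison for the damped smooth contrast** (heart of S-21.1; see the module
docstring).  For a sign `σ = ±1`: `σ · e^{-∫ₛ^τ k} · χ̃(τ, x) ≤ C₀` on `[s, t] × ℝ³`. -/
theorem sign_mul_dampedSmoothContrast_le (hν : 0 ≤ ν) (hst : s < t)
    (hcl : IsClassicalNSSolutionOn (Icc s t) ν 0 u p)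
    (hodd : ∀ τ ∈ Icc s t, IsAxisymmetric (u τ) ∧ IsOddSwirlClass (u τ))
    (hdecay : ∀ ε : ℝ, 0 < ε → ∃ R : ℝ, ∀ τ ∈ Icc s t, ∀ x : EuclideanSpace ℝ (Fin 3),
        R ≤ ‖x‖ → |oddContrast (u τ) x| ≤ ε)
    {C₀ : ℝ} {k : ℝ → ℝ} (hC₀ : ∀ x, |oddContrast (u s) x| ≤ C₀)
    (hk : ∀ τ ∈ Icc s t, ∀ x : EuclideanSpace ℝ (Fin 3), x 2 ≠ 0 → sheetCompression (u τ) x ≤ k τ)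
    (hki : ContinuousOn k (Icc s t)) {σ : ℝ} (hσ : σ = 1 ∨ σ = -1) :
    ∀ τ ∈ Icc s t, ∀ x : EuclideanSpace ℝ (Fin 3),
      σ * (Real.exp (-(∫ r in s..τ, k r)) * zQuot (swirl (u τ)) x) ≤ C₀ := by
  have hσabs : ∀ a : ℝ, σ * a ≤ |a| := fun a => by
    rcases hσ with h | h
    · rw [h, one_mul]; exact le_abs_self a
    · rw [h, neg_one_mul]; exact neg_le_abs a
  have hC₀0 : 0 ≤ C₀ := by
    have h := hC₀ 0
    have h0 : oddContrast (u s) 0 = 0 := by simp [oddContrast]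
    rw [h0, abs_zero] at h
    exact h
  -- regularity of the velocity and of `χ̃`
  have hsm := hcl.smooth_velocity
  have hU : UniqueDiffOn ℝ (Icc s t) := uniqueDiffOn_Icc hst
  have hvs : ∀ τ ∈ Icc s t, ContDiff ℝ ∞ (u τ) := fun τ hτ => hcl.contDiff_velocity hτ
  have hv1 : ∀ τ ∈ Icc s t, ContDiff ℝ 1 (u τ) := fun τ hτ => (hvs τ hτ).of_le (by norm_cast)
  have hχfam := smoothContrast_family hst hcl
  have hχ : ∀ τ ∈ Icc s t, ContDiff ℝ ∞ (zQuot (swirl (u τ))) := fun τ hτ =>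
    contDiff_smoothContrast hcl hτ
  have hχc : ∀ τ ∈ Icc s t, Continuous (zQuot (swirl (u τ))) := fun τ hτ => (hχ τ hτ).continuous
  -- the continuous extension `kb` of `k` to `ℝ` and its primitive
  set kb : ℝ → ℝ := fun r => k (max s (min r t)) with hkb
  have hkb_eq : ∀ r ∈ Icc s t, kb r = k r := fun r hr => by
    simp only [hkb, min_eq_left hr.2, max_eq_right hr.1]
  have hkbc : Continuous kb := by
    refine hki.comp_continuous (continuous_const.max (continuous_id.min continuous_const)) fun r => ?_
    exact ⟨le_max_left _ _, max_le hst.le (min_le_right _ _)⟩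
  have hKeq : ∀ τ ∈ Icc s t, ∫ r in s..τ, kb r = ∫ r in s..τ, k r := fun τ hτ => by
    refine intervalIntegral.integral_congr fun r hr => hkb_eq r ?_
    rw [uIcc_of_le hτ.1] at hr
    exact ⟨hr.1, hr.2.trans hτ.2⟩
  have hKc : Continuous fun τ => ∫ r in s..τ, kb r :=
    intervalIntegral.continuous_primitive (fun a b => hkbc.intervalIntegrable a b) s
  have hKd : ∀ τ, HasDerivAt (fun τ => ∫ r in s..τ, kb r) (kb τ) τ := fun τ =>
    (hkbc.integral_hasStrictDerivAt s τ).hasDerivAt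
  -- a bound of `|∫ kb|` on `[s, t]` and of the damping factor
  obtain ⟨kM, hkM⟩ := isCompact_Icc.exists_bound_of_continuousOn (hkbc.continuousOn (s := Icc s t))
  have hKle : ∀ τ ∈ Icc s t, |∫ r in s..τ, kb r| ≤ kM * (t - s) := by
    intro τ hτ
    have h1 : ‖∫ r in s..τ, kb r‖ ≤ kM * |τ - s| := by
      refine intervalIntegral.norm_integral_le_of_norm_le_const fun r hr => hkM r ?_
      rw [uIoc_of_le hτ.1] at hr
      exact ⟨hr.1.le, hr.2.trans hτ.2⟩
    rw [Real.norm_eq_abs] at h1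
    have hkM0 : 0 ≤ kM := (norm_nonneg _).trans (hkM s ⟨le_rfl, hst.le⟩)
    calc |∫ r in s..τ, kb r| ≤ kM * |τ - s| := h1
      _ ≤ kM * (t - s) := by
          rw [abs_of_nonneg (by linarith [hτ.1])]
          exact mul_le_mul_of_nonneg_left (by linarith [hτ.2]) hkM0
  set Emax : ℝ := Real.exp (kM * (t - s)) with hEmax
  have hEmax0 : 0 < Emax := Real.exp_pos _
  have hEle : ∀ τ ∈ Icc s t, Real.exp (-(∫ r in s..τ, kb r)) ≤ Emax := fun τ hτ =>
    Real.exp_le_exp.2 ((neg_le_abs _).trans (hKle τ hτ))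
  -- the bound of `|χ̃(s, ·)|` everywhere and `χ̃ = 0` on the axis
  have hinit : ∀ x, |zQuot (swirl (u s)) x| ≤ C₀ := fun x =>
    abs_le_of_forall_off_sheet (R₀ := 0) (hχc s ⟨le_rfl, hst.le⟩)
      (fun y hy _ => by
        rw [← oddContrast_eq_zQuot (hv1 s ⟨le_rfl, hst.le⟩) (hodd s ⟨le_rfl, hst.le⟩).1
          (hodd s ⟨le_rfl, hst.le⟩).2 hy]
        exact hC₀ y) x (norm_nonneg x)
  have haxis : ∀ τ ∈ Icc s t, ∀ x : EuclideanSpace ℝ (Fin 3), cylRadius x = 0 →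
      zQuot (swirl (u τ)) x = 0 := fun τ hτ x hx =>
    zQuot_swirl_eq_zero_of_axis (hv1 τ hτ) (hodd τ hτ).1 (hodd τ hτ).2
      ((cylRadius_eq_zero_iff x).1 hx).1 ((cylRadius_eq_zero_iff x).1 hx).2
  -- the claim for every `η > 0`
  suffices key : ∀ η : ℝ, 0 < η → ∀ τ ∈ Icc s t, ∀ x : EuclideanSpace ℝ (Fin 3),
      σ * (Real.exp (-(∫ r in s..τ, kb r)) * zQuot (swirl (u τ)) x) ≤ C₀ + η by
    intro τ hτ x
    rw [← hKeq τ hτ]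
    exact le_of_forall_pos_le_add fun η hη => key η hη τ hτ x
  intro η hη τ₀ hτ₀ x₀
  -- decay radius for `ε' = η / (2 Emax)`
  obtain ⟨R₀, hR₀⟩ := hdecay (η / 2 / Emax) (by positivity)
  have hfar : ∀ τ ∈ Icc s t, ∀ x : EuclideanSpace ℝ (Fin 3), R₀ ≤ ‖x‖ →
      |zQuot (swirl (u τ)) x| ≤ η / 2 / Emax := fun τ hτ =>
    abs_le_of_forall_off_sheet (hχc τ hτ) fun y hy hR => by
      rw [← oddContrast_eq_zQuot (hv1 τ hτ) (hodd τ hτ).1 (hodd τ hτ).2 hy]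
      exact hR₀ τ hτ y hR
  -- the ball, the velocity bound on it, the constants
  set R : ℝ := max R₀ ‖x₀‖ with hR
  have hx₀R : x₀ ∈ closedBall (0 : EuclideanSpace ℝ (Fin 3)) R :=
    mem_closedBall_zero_iff.2 (le_max_right _ _)
  have hR0 : 0 ≤ R := (norm_nonneg _).trans (le_max_right _ _)
  set K : Set (EuclideanSpace ℝ (Fin 3)) := closedBall 0 R with hK
  set U : Set (EuclideanSpace ℝ (Fin 3)) := ball 0 R ∩ {x | cylRadius x ≠ 0} with hUdef
  have hKc' : IsCompact K := isCompact_closedBall _ _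
  have hUo : IsOpen U := isOpen_ball.inter (isOpen_ne_fun continuous_cylRadius continuous_const)
  have hUK : U ⊆ K := fun x hx => ball_subset_closedBall hx.1
  obtain ⟨V', hV'⟩ := (isCompact_Icc.prod hKc').exists_bound_of_continuousOn
    (hsm.continuousOn.mono (prod_mono Subset.rfl (subset_univ _)) : ContinuousOn (uncurry u) (Icc s t ×ˢ K))
  set V : ℝ := max V' 0 with hVdef
  have hV0 : 0 ≤ V := le_max_right _ _
  have hV : ∀ τ ∈ Icc s t, ∀ x ∈ K, ‖u τ x‖ ≤ V := fun τ hτ x hx =>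
    (hV' (τ, x) ⟨hτ, hx⟩).trans (le_max_left _ _)
  set β : ℝ := 10 * ν + V + 1 with hβ
  have hβ0 : 0 ≤ β := by rw [hβ]; positivity
  set M : ℝ := C₀ + η / 2 with hM
  have hM0 : 0 < M := by rw [hM]; positivity
  set ε : ℝ := η / 2 / (Real.exp (β * (t - s)) * (1 + R ^ 2)) with hεdef
  have hε : 0 < ε := by rw [hεdef]; positivity
  have hεle : ∀ τ ∈ Icc s t, ∀ x ∈ K, ε * Real.exp (β * (τ - s)) * (1 + ‖x‖ ^ 2) ≤ η / 2 := by
    intro τ hτ x hx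
    have hxR : ‖x‖ ≤ R := mem_closedBall_zero_iff.1 hx
    have h1 : Real.exp (β * (τ - s)) ≤ Real.exp (β * (t - s)) :=
      Real.exp_le_exp.2 (mul_le_mul_of_nonneg_left (by linarith [hτ.2]) hβ0)
    have h2 : 1 + ‖x‖ ^ 2 ≤ 1 + R ^ 2 := by nlinarith [norm_nonneg x]
    have hD : 0 < Real.exp (β * (t - s)) * (1 + R ^ 2) := by positivity
    calc ε * Real.exp (β * (τ - s)) * (1 + ‖x‖ ^ 2)
        ≤ ε * Real.exp (β * (t - s)) * (1 + R ^ 2) := by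
          have := mul_le_mul h1 h2 (by positivity) (by positivity)
          calc ε * Real.exp (β * (τ - s)) * (1 + ‖x‖ ^ 2)
              = ε * (Real.exp (β * (τ - s)) * (1 + ‖x‖ ^ 2)) := by ring
            _ ≤ ε * (Real.exp (β * (t - s)) * (1 + R ^ 2)) := mul_le_mul_of_nonneg_left this hε.le
            _ = ε * Real.exp (β * (t - s)) * (1 + R ^ 2) := by ring
      _ = η / 2 := by rw [hεdef]; field_simp
  -- the damping factor and its derivative
  have hEd : ∀ τ, HasDerivAt (fun τ => Real.exp (-(∫ r in s..τ, kb r)))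
      (Real.exp (-(∫ r in s..τ, kb r)) * -kb τ) τ := fun τ => (hKd τ).neg.exp
  have hE0 : ∀ τ, 0 < Real.exp (-(∫ r in s..τ, kb r)) := fun τ => Real.exp_pos _
  -- the comparison function and its time derivative
  set w : ℝ → EuclideanSpace ℝ (Fin 3) → ℝ := fun τ x =>
    σ * (Real.exp (-(∫ r in s..τ, kb r)) * zQuot (swirl (u τ)) x)
      - (M + ε * Real.exp (β * (τ - s)) * (1 + ‖x‖ ^ 2)) with hw
  set wₜ : ℝ → EuclideanSpace ℝ (Fin 3) → ℝ := fun τ x =>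
    σ * (Real.exp (-(∫ r in s..τ, kb r)) * -kb τ * zQuot (swirl (u τ)) x
      + Real.exp (-(∫ r in s..τ, kb r)) *
        timeDerivWithin (Icc s t) (fun r => zQuot (swirl (u r))) τ x)
      - β * (ε * Real.exp (β * (τ - s)) * (1 + ‖x‖ ^ 2)) with hwₜ
  -- (a) joint continuity
  have hc : ContinuousOn (uncurry w) (Icc s t ×ˢ K) := by
    have hgc : ContinuousOn (uncurry fun τ x => zQuot (swirl (u τ)) x) (Icc s t ×ˢ K) :=
      hχfam.continuousOn.mono (prod_mono Subset.rfl (subset_univ _))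
    have hEc : Continuous fun q : ℝ × EuclideanSpace ℝ (Fin 3) =>
        Real.exp (-(∫ r in s..q.1, kb r)) :=
      (Real.continuous_exp.comp hKc.neg).comp continuous_fst
    have h2 : Continuous fun q : ℝ × EuclideanSpace ℝ (Fin 3) =>
        M + ε * Real.exp (β * (q.1 - s)) * (1 + ‖q.2‖ ^ 2) := by fun_prop
    refine (((continuousOn_const (c := σ)).mul (hEc.continuousOn.mul hgc)).sub h2.continuousOn).congr
      fun q _ => ?_
    simp only [hw, uncurry, Pi.sub_apply, Pi.mul_apply]
  -- (b) the left time derivative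
  have ht : ∀ τ ∈ Ioc s t, ∀ x ∈ U, HasDerivWithinAt (fun r => w r x) (wₜ τ x) (Icc s τ) τ := by
    intro τ hτ x _
    have hτI : τ ∈ Icc s t := ⟨hτ.1.le, hτ.2⟩
    have hg' : HasDerivWithinAt (fun r => zQuot (swirl (u r)) x)
        (timeDerivWithin (Icc s t) (fun r => zQuot (swirl (u r))) τ x) (Icc s t) τ :=
      hχfam.hasDerivWithinAt_timeDerivWithin hU hτI x
    have hEg := (hEd τ).hasDerivWithinAt.mul hg'
    have hexp : HasDerivWithinAt (fun r => M + ε * Real.exp (β * (r - s)) * (1 + ‖x‖ ^ 2))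
        (ε * (Real.exp (β * (τ - s)) * β) * (1 + ‖x‖ ^ 2)) (Icc s t) τ := by
      have h1 : HasDerivAt (fun r => Real.exp (β * (r - s))) (Real.exp (β * (τ - s)) * β) τ := by
        have := (((hasDerivAt_id τ).sub_const s).const_mul β).exp
        simpa using this
      exact (((h1.const_mul ε).mul_const (1 + ‖x‖ ^ 2)).const_add M).hasDerivWithinAt
    have h := ((hEg.const_mul σ).sub hexp).mono (Icc_subset_Icc_right hτ.2)
    simp only [hw, hwₜ]
    exact h.congr_deriv (by ring)
  -- (c) the sub-solution implication at positive local maxima (`dampedContrast_subsolution`)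
  have hsub : ∀ τ ∈ Ioc s t, ∀ x ∈ U, 0 < w τ x → IsLocalMax (w τ) x → wₜ τ x ≤ 0 := by
    intro τ hτ x hx hwpos hloc
    have hτI : τ ∈ Icc s t := ⟨hτ.1.le, hτ.2⟩
    have hr : cylRadius x ≠ 0 := hx.2
    have hxK : x ∈ K := hUK hx
    set c : ℝ := ε * Real.exp (β * (τ - s)) with hcdef
    have hc0 : 0 < c := by positivity
    set a : ℝ := σ * Real.exp (-(∫ r in s..τ, kb r)) with hadef
    have hwfun : w τ = fun y => a * zQuot (swirl (u τ)) y - (M + c * (1 + ‖y‖ ^ 2)) := by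
      funext y; simp only [hw, hadef, hcdef]; ring
    have hpos' : 0 < a * zQuot (swirl (u τ)) x - (M + c * (1 + ‖x‖ ^ 2)) := by
      have h := hwpos; rw [hwfun] at h; exact h
    have hloc' : IsLocalMax (fun y => a * zQuot (swirl (u τ)) y - (M + c * (1 + ‖y‖ ^ 2))) x := by
      rw [← hwfun]; exact hloc
    have hstep := dampedContrast_subsolution hν hst hcl hodd hτI hr (hV τ hτI x hxK) hc0 hM0.le
      (fun y hy => (hkb_eq τ hτI).symm ▸ hk τ hτI y hy) hpos' hloc'
    have hwt : wₜ τ x = (-(kb τ) * (a * zQuot (swirl (u τ)) x)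
        + a * timeDerivWithin (Icc s t) (fun r => zQuot (swirl (u r))) τ x)
        - β * (c * (1 + ‖x‖ ^ 2)) := by
      simp only [hwₜ, hadef, hcdef]; ring
    have hA0 : 0 < c * (1 + ‖x‖ ^ 2) := by positivity
    have eβ : β * (c * (1 + ‖x‖ ^ 2)) = (10 * ν + V) * (c * (1 + ‖x‖ ^ 2)) + c * (1 + ‖x‖ ^ 2) := by
      rw [hβ]; ring
    rw [hwt]
    linarith
  -- (d) the parabolic boundary: `τ = s`
  have hbot : ∀ x ∈ K, w s x ≤ 0 := by
    intro x _
    have hEs : Real.exp (-(∫ r in s..s, kb r)) = 1 := by simp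
    simp only [hw, hEs, one_mul, sub_self, mul_zero, Real.exp_zero, mul_one]
    have h1 := hσabs (zQuot (swirl (u s)) x)
    have h2 := hinit x
    have h3 : 0 ≤ ε * (1 + ‖x‖ ^ 2) := by positivity
    linarith
  -- (e) the parabolic boundary: the axis and the sphere
  have hlat : ∀ τ ∈ Icc s t, ∀ x ∈ K \ U, w τ x ≤ 0 := by
    intro τ hτ x hx
    have hxK : ‖x‖ ≤ R := mem_closedBall_zero_iff.1 hx.1
    have hpos : 0 < M + ε * Real.exp (β * (τ - s)) * (1 + ‖x‖ ^ 2) := by positivity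
    simp only [hw]
    by_cases hax : cylRadius x = 0
    · rw [haxis τ hτ x hax, mul_zero, mul_zero]
      linarith
    · have hxR : ‖x‖ = R := by
        have hnot : x ∉ ball (0 : EuclideanSpace ℝ (Fin 3)) R := fun hb => hx.2 ⟨hb, hax⟩
        have : R ≤ ‖x‖ := by simpa using hnot
        exact le_antisymm hxK this
      have hR₀x : R₀ ≤ ‖x‖ := by rw [hxR]; exact le_max_left _ _
      have h1 : σ * (Real.exp (-(∫ r in s..τ, kb r)) * zQuot (swirl (u τ)) x) ≤ η / 2 := by
        refine (hσabs _).trans ?_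
        rw [abs_mul, abs_of_pos (hE0 τ)]
        calc Real.exp (-(∫ r in s..τ, kb r)) * |zQuot (swirl (u τ)) x|
            ≤ Emax * (η / 2 / Emax) :=
              mul_le_mul (hEle τ hτ) (hfar τ hτ x hR₀x) (abs_nonneg _) hEmax0.le
          _ = η / 2 := by field_simp
      have h2 : 0 ≤ ε * Real.exp (β * (τ - s)) * (1 + ‖x‖ ^ 2) := by positivity
      rw [hM] at hpos ⊢
      linarith
  -- conclusion at `(τ₀, x₀)`
  have hmain := weak_max_principle_pos hKc' hUo hUK hc ht hsub hbot hlat τ₀ hτ₀ x₀ hx₀R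
  simp only [hw] at hmain
  have hε₀ := hεle τ₀ hτ₀ x₀ hx₀R
  linarith

/-- **S-21.1 `OddContrastMaxPrinciple` — the ODD-CONTRAST MAXIMUM PRINCIPLE, PROVED** (support
statement of nsreg-p2's ROUND-21, `Theorems/SheetLaws.lean`): for a classical solution of the
unforced Navier–Stokes system (`ν > 0`) on `ℝ³ × S`, `[s, t] ⊆ S`, in the axisymmetric odd-swirl
class, with `χ = Γ/z` decaying at spatial infinity uniformly on `[s, t]`, `|χ(s, ·)| ≤ C₀` and a
continuous majorant `-u_z/z ≤ k` off the sheet: `|χ(t, x)| ≤ C₀ · exp(∫ₛᵗ k)` for every `x`.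
Proof: `sign_mul_dampedSmoothContrast_le` for `σ = ±1` (the literal `χ` equals `χ̃` off the sheet
and vanishes on it). -/
theorem oddContrastMaxPrinciple_holds : OddContrastMaxPrinciple := by
  intro S ν hν u p hsol s t hst hS hodd hdecay C₀ k hC₀ hk hki x
  have hC₀0 : 0 ≤ C₀ := by
    have h := hC₀ 0
    have h0 : oddContrast (u s) 0 = 0 := by simp [oddContrast]
    rw [h0, abs_zero] at h
    exact h
  rcases hst.eq_or_lt with rfl | hst'
  · simpa using hC₀ x
  have hcl : IsClassicalNSSolutionOn (Icc s t) ν 0 u p := hsol.mono hS (uniqueDiffOn_Icc hst')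
  by_cases hz : x 2 = 0
  · have : oddContrast (u t) x = 0 := by simp [oddContrast, hz]
    rw [this, abs_zero]
    positivity
  · have htI : t ∈ Icc s t := ⟨hst, le_rfl⟩
    have hv1 : ContDiff ℝ 1 (u t) := (hcl.contDiff_velocity htI).of_le (by norm_cast)
    rw [oddContrast_eq_zQuot hv1 (hodd t htI).1 (hodd t htI).2 hz]
    set Et := Real.exp (-(∫ r in s..t, k r)) with hEt
    have hE0 : 0 < Et := Real.exp_pos _
    have h1 := sign_mul_dampedSmoothContrast_le hν.le hst' hcl hodd hdecay hC₀ hk hki (Or.inl rfl) t htI x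
    have h2 := sign_mul_dampedSmoothContrast_le hν.le hst' hcl hodd hdecay hC₀ hk hki (Or.inr rfl) t htI x
    rw [one_mul] at h1
    rw [neg_one_mul] at h2
    have h3 : |Et * zQuot (swirl (u t)) x| ≤ C₀ := abs_le.2 ⟨by linarith, h1⟩
    rw [abs_mul, abs_of_pos hE0] at h3
    have h4 : |zQuot (swirl (u t)) x| ≤ C₀ / Et := by
      rw [le_div_iff₀ hE0, mul_comm]; exact h3
    calc |zQuot (swirl (u t)) x| ≤ C₀ / Et := h4
      _ = C₀ * Real.exp (∫ τ in s..t, k τ) := by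
          rw [hEt, Real.exp_neg, div_inv_eq_mul]

/-- **S-21.2 `OddClassDSSCompressionLaw` — the DSS sheet-compression law, UNCONDITIONAL**: a
discretely self-similar classical blow-up solution in the odd-swirl class with decaying, non-trivial
odd contrast must compress toward its sheet with per-period budget `∫ k ≥ ln λ` for every continuous
compression majorant `k` (the planner's `oddClassDSSCompressionLaw_of_maxPrinciple` fed with
`oddContrastMaxPrinciple_holds`). -/
theorem oddClassDSSCompressionLaw_holds : OddClassDSSCompressionLaw :=
  oddClassDSSCompressionLaw_of_maxPrinciple oddContrastMaxPrinciple_holds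

end

end Summit.NavierStokesRegularity.NavierStokesRegularity.Theorems.SheetLaws
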